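import Mathlib
import Summits.Ventures.PercRepro.TriangleCapTriangleFreeThreeD

/-!
# PercRepro — THE EQUALITY LOCUS TWO BELOW THE DIAGONAL ON THE TRIANGLE-FREE CLASS (p3, gen 36; part 46)

`two_below_diagonal_cliqueFree_equality`: a triangle-free graph on `k ≥ 7` vertices with `m ≥ 2k − 3` edges and
`Σ_v d(v)² + 2 (k − 3) = m·k` is bipartite spanning with EXACTLY two missing cross pairs, and the two share a vertex —
it is a complete bipartite graph minus two edges at one vertex.  (Non-bipartite triangle-free graphs have
`Σ deficit ≥ 6 (k − 4) > 4 (k − 3)` for `k ≥ 7` (TriangleCapTriangleFreeThreeC); a bipartite spanning graph with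
`N₀ ≥ 3` missing pairs has `Σ_v d(v)² + 3 (k − 4) ≤ m·k` (TriangleCapBipartiteThree), `N₀ ≤ 1` gives
`Σ deficit ∈ {0, 2 (k − 2)}`, and `N₀ = 2` with disjoint pairs gives `2 (k − 2)` — all `≠ 4 (k − 3)`.)
Axioms: standard.
-/

namespace PercRepro

namespace TriangleCap

namespace C047

open Finset

variable {V : Type*} [Fintype V] [DecidableEq V]

omit [Fintype V] in
/-- `miss x` is the number of missing pairs with first coordinate `x`. -/
theorem miss_eq_card_fibre (D : SimpleGraph V) [DecidableRel D.Adj] (X Y : Finset V) {x : V} (hx : x ∈ X) :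
    miss D Y x = ((missing D X Y).filter (fun h => h.1 = x)).card := by
  unfold miss missing
  have e : ((X ×ˢ Y).filter (fun p => ¬ D.Adj p.1 p.2)).filter (fun h => h.1 = x) =
      (Y.filter (fun y => ¬ D.Adj x y)).image (fun y => (x, y)) := by
    ext q
    simp only [mem_filter, mem_product, mem_image]
    constructor
    · rintro ⟨⟨⟨hq1, hq2⟩, hq3⟩, hq4⟩
      exact ⟨q.2, ⟨hq2, by rw [← hq4]; exact hq3⟩, by rw [← hq4]⟩
    · rintro ⟨y, ⟨hy1, hy2⟩, rfl⟩
      exact ⟨⟨⟨hx, hy1⟩, hy2⟩, rfl⟩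
  rw [e, card_image_of_injective _ (fun a b h => (Prod.mk.inj h).2)]

omit [Fintype V] in
/-- `|{x′ ∈ X : ¬ x′ ~ y}|` is the number of missing pairs with second coordinate `y`. -/
theorem missY_eq_card_fibre (D : SimpleGraph V) [DecidableRel D.Adj] (X Y : Finset V) {y : V} (hy : y ∈ Y) :
    (X.filter (fun x => ¬ D.Adj x y)).card = ((missing D X Y).filter (fun h => h.2 = y)).card := by
  unfold missing
  have e : ((X ×ˢ Y).filter (fun p => ¬ D.Adj p.1 p.2)).filter (fun h => h.2 = y) =
      (X.filter (fun x => ¬ D.Adj x y)).image (fun x => (x, y)) := by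
    ext q
    simp only [mem_filter, mem_product, mem_image]
    constructor
    · rintro ⟨⟨⟨hq1, hq2⟩, hq3⟩, hq4⟩
      exact ⟨q.1, ⟨hq1, by rw [← hq4]; exact hq3⟩, by rw [← hq4]⟩
    · rintro ⟨x, ⟨hx1, hx2⟩, rfl⟩
      exact ⟨⟨⟨hx1, hy⟩, hx2⟩, rfl⟩
  rw [e, card_image_of_injective _ (fun a b h => (Prod.mk.inj h).1)]

/-- **THE EQUALITY LOCUS TWO BELOW THE DIAGONAL:** a triangle-free graph on `k ≥ 7` vertices with `m ≥ 2k − 3` edges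
and `Σ_v d(v)² + 2 (k − 3) = m·k` is bipartite spanning with exactly two missing cross pairs sharing a vertex. -/
theorem two_below_diagonal_cliqueFree_equality (D : SimpleGraph V) [DecidableRel D.Adj] (hfree : D.CliqueFree 3)
    (hk : 7 ≤ Fintype.card V) (hm : 2 * Fintype.card V ≤ D.edgeFinset.card + 3)
    (heq : ∑ v, deg D v * deg D v + 2 * (Fintype.card V - 3) = D.edgeFinset.card * Fintype.card V) :
    ∃ A : Finset V, (∀ x y, D.Adj x y → (x ∈ A ↔ y ∉ A)) ∧ (missing D A Aᶜ).card = 2 ∧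
      ∃ w, ∀ h ∈ missing D A Aᶜ, h.1 = w ∨ h.2 = w := by
  have hid := two_mul_sum_deg_sq_add_sum_deficit D
  rw [card_triangles3_eq_zero_of_cliqueFree D hfree] at hid
  have hid2 : 2 * ∑ v, deg D v * deg D v + ∑ p ∈ adjPairsAll D, deficit D p =
      2 * (D.edgeFinset.card * Fintype.card V) := by rw [hid]; ring
  have hF : ∑ p ∈ adjPairsAll D, deficit D p = 4 * (Fintype.card V - 3) := by omega
  by_cases hb : ∃ A : Finset V, ∀ x y, D.Adj x y → (x ∈ A ↔ y ∉ A)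
  · obtain ⟨A, hA⟩ := hb
    refine ⟨A, hA, ?_⟩
    have hG := sum_deficit_eq_two_mul_of_bipartite D A hA
    rw [hF] at hG
    -- `N₀ ≥ 3` is excluded by the `r = 3` bipartite stability
    have hN3 : (missing D A Aᶜ).card ≤ 2 := by
      by_contra h
      have := bipartite_stability_three D A hA (by omega) hm
      omega
    -- the missing pairs pay their ends' degrees: `G = Σ_{h} (d(h.1) + d(h.2))`
    have hsum : ∑ h ∈ missing D A Aᶜ, (deg D h.1 + deg D h.2) =
        ∑ x ∈ A, miss D Aᶜ x * deg D x + ∑ y ∈ Aᶜ, (A.filter (fun x => ¬ D.Adj x y)).card * deg D y := by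
      rw [sum_add_distrib, sum_deg_fst_missing, sum_deg_snd_missing]
    -- `N₀ = 0`: `G = 0`
    have hN0 : (missing D A Aᶜ).card ≠ 0 := by
      intro h0
      rw [card_eq_zero] at h0
      rw [h0, sum_empty] at hsum
      omega
    -- `N₀ = 1`: `G = k − 2`
    have hN1 : (missing D A Aᶜ).card ≠ 1 := by
      intro h1
      obtain ⟨h₁, hh⟩ := card_eq_one.mp h1
      rw [hh, sum_singleton] at hsum
      have hmem : h₁ ∈ missing D A Aᶜ := by rw [hh]; exact mem_singleton_self _
      have hmem' := hmem
      unfold missing at hmem'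
      rw [mem_filter, mem_product] at hmem'
      have hx := deg_add_miss_of_bipartite D A hA hmem'.1.1
      have hy := deg_add_missY_of_bipartite D A hA (mem_compl.mp hmem'.1.2)
      have hmx := miss_eq_card_fibre D A Aᶜ hmem'.1.1
      have hmy := missY_eq_card_fibre D A Aᶜ hmem'.1.2
      rw [hh] at hmx hmy
      have e1 : ({h₁} : Finset (V × V)).filter (fun h => h.1 = h₁.1) = {h₁} := by
        apply filter_true_of_mem
        intro h hh'
        rw [mem_singleton] at hh'
        rw [hh']
      have e2 : ({h₁} : Finset (V × V)).filter (fun h => h.2 = h₁.2) = {h₁} := by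
        apply filter_true_of_mem
        intro h hh'
        rw [mem_singleton] at hh'
        rw [hh']
      rw [e1, card_singleton] at hmx
      rw [e2, card_singleton] at hmy
      have hk' := card_add_card_compl A
      omega
    have hN2 : (missing D A Aᶜ).card = 2 := by omega
    refine ⟨hN2, ?_⟩
    obtain ⟨h₁, h₂, hne, hh⟩ := card_eq_two.mp hN2
    have hmem₁ : h₁ ∈ missing D A Aᶜ := by rw [hh]; exact mem_insert_self _ _
    have hmem₂ : h₂ ∈ missing D A Aᶜ := by rw [hh]; exact mem_insert_of_mem (mem_singleton_self _)
    have hm₁ := hmem₁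
    have hm₂ := hmem₂
    unfold missing at hm₁ hm₂
    rw [mem_filter, mem_product] at hm₁ hm₂
    rw [hh, sum_pair hne] at hsum
    -- if the two pairs share no vertex, every end has exactly one missing pair and `G = 2 (k − 2)`
    by_contra hshare
    have hshare' : h₁.1 ≠ h₂.1 ∧ h₁.2 ≠ h₂.2 := by
      constructor
      · intro e
        exact hshare ⟨h₁.1, fun h hh' => by
          rw [hh, mem_insert, mem_singleton] at hh'
          rcases hh' with rfl | rfl
          · exact Or.inl rfl
          · exact Or.inl e.symm⟩
      · intro e
        exact hshare ⟨h₁.2, fun h hh' => by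
          rw [hh, mem_insert, mem_singleton] at hh'
          rcases hh' with rfl | rfl
          · exact Or.inr rfl
          · exact Or.inr e.symm⟩
    have fib1 : ∀ h ∈ missing D A Aᶜ, ((missing D A Aᶜ).filter (fun h' => h'.1 = h.1)).card = 1 := by
      intro h hmem
      rw [card_eq_one]
      refine ⟨h, ?_⟩
      ext h'
      rw [mem_filter, mem_singleton]
      constructor
      · rintro ⟨hm', he⟩
        rw [hh, mem_insert, mem_singleton] at hm' hmem
        rcases hm' with rfl | rfl <;> rcases hmem with rfl | rfl
        · rfl
        · exact (hshare'.1 he).elim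
        · exact (hshare'.1 he.symm).elim
        · rfl
      · rintro rfl
        exact ⟨hmem, rfl⟩
    have fib2 : ∀ h ∈ missing D A Aᶜ, ((missing D A Aᶜ).filter (fun h' => h'.2 = h.2)).card = 1 := by
      intro h hmem
      rw [card_eq_one]
      refine ⟨h, ?_⟩
      ext h'
      rw [mem_filter, mem_singleton]
      constructor
      · rintro ⟨hm', he⟩
        rw [hh, mem_insert, mem_singleton] at hm' hmem
        rcases hm' with rfl | rfl <;> rcases hmem with rfl | rfl
        · rfl
        · exact (hshare'.2 he).elim
        · exact (hshare'.2 he.symm).elim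
        · rfl
      · rintro rfl
        exact ⟨hmem, rfl⟩
    have d1 := deg_add_miss_of_bipartite D A hA hm₁.1.1
    have d2 := deg_add_miss_of_bipartite D A hA hm₂.1.1
    have d3 := deg_add_missY_of_bipartite D A hA (mem_compl.mp hm₁.1.2)
    have d4 := deg_add_missY_of_bipartite D A hA (mem_compl.mp hm₂.1.2)
    rw [miss_eq_card_fibre D A Aᶜ hm₁.1.1, fib1 h₁ hmem₁] at d1
    rw [miss_eq_card_fibre D A Aᶜ hm₂.1.1, fib1 h₂ hmem₂] at d2
    rw [missY_eq_card_fibre D A Aᶜ hm₁.1.2, fib2 h₁ hmem₁] at d3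
    rw [missY_eq_card_fibre D A Aᶜ hm₂.1.2, fib2 h₂ hmem₂] at d4
    have hk' := card_add_card_compl A
    omega
  · -- not bipartite spanning: the `r = 3` core gives `Σ deficit ≥ 6 (k − 4) > 4 (k − 3)`
    exfalso
    obtain ⟨u, hu⟩ := exists_deg_four_of_dense D hk hm
    have hne : (univ.filter (fun w => D.Adj u w)).Nonempty := by
      apply card_pos.mp
      show 0 < deg D u
      omega
    obtain ⟨v, hv⟩ := hne
    rw [mem_filter] at hv
    have := six_mul_le_sum_deficit_of_not_bipartite D hfree hv.2 hu hb
    omega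

end C047

end TriangleCap

end PercRepro
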